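import Literature.Analysis.FluidPDE.KatoUniquenessPairing
import Literature.Analysis.FluidPDE.HeatDuhamelEnergy
import HarnessLib

/-!
# The duality identity for the difference of two `L³` mild solutions

Analysis/FluidPDE support file for the uniqueness theorem of Furioli–Lemarié-Rieusset–Terraneo
(`Literature.Analysis.FluidPDE.kato_unique`), second step of the `L²`-duality proof of the local forward-uniqueness
fact `Fluid.IsMildNSSolutionOn.ae_eq_Ico_of_ae_eq_Icc_three` (Lemarié-Rieusset 2016, Thm. 7.7,
after Monniaux and Lions–Masmoudi). For two unforced mild solutions `u`, `v` in the duality form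
`Fluid.IsMildNSSolutionOn` (tested against `φ ∈ 𝒱`, the heat semigroup acting on the test),
agreeing on `[0, τ₀]`, and a space-time test field `Θ` with divergence-free slices and time
support in `[a, b] ⊆ (-∞, τ₁]`, the main result `Fluid.IsMildNSSolutionOn.slab_duality` is

  `∫_{(τ₀,τ₁]} ∫⟪u(t) - v(t), Θ(t)⟫ dt = ∫_{(τ₀,τ₁]} ∫ (⟪u, D𝒰[Θ] u⟫ - ⟪v, D𝒰[Θ] v⟫) dτ`,

where `𝒰[Θ] = Fluid.heatDuhamelBack ν Θ`, `𝒰[Θ](τ) = ∫_{σ>0} e^{νσΔ} Θ(τ + σ) dσ`, solves the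
backward heat equation `-∂_τ 𝒰 - νΔ𝒰 = Θ` (`HeatDuhamelBack.lean`); the split form
`Fluid.IsMildNSSolutionOn.slab_duality_split` reads `… = ∫∫ (⟪w, D𝒰 u⟫ + ⟪v, D𝒰 w⟫)`,
`w = u - v`. Ingredients:

* `Fluid.continuousOn_heatExtension_param`: joint continuity of `(p, σ, x) ↦ e^{σΔ}G(p)(x)` for a
  jointly continuous bounded family of data, whence the joint continuity of the transport kernel
  `K_t(τ, x) = 1_{τ<t} D(e^{ν(t-τ)Δ}Θ(t))(x)` on `{τ < t}` and its measurability
  (`Fluid.IsSpaceTimeTestOn.aestronglyMeasurable_transportKernel(_slice)`);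
* `Fluid.IsSpaceTimeTestOn.setIntegral_transportKernel_eq_fderiv_heatDuhamelBack`:
  `∫_{t ∈ (τ₀,τ₁]} K_t(τ, x) dt = D𝒰[Θ](τ)(x)` (substitution `t = τ + σ`, derivative on the data);
* `Fluid.setIntegral_slab_duality`: the abstract Fubini bookkeeping on
  `(τ₀,τ₁] × ((τ₀,τ₁] × E)` for a general `L³`-bounded measurable kernel (trilinear Hölder bounds
  `Fluid.lintegral_enorm_inner_clm_apply_le`, `Fluid.integrable_transportIntegrand(_space/_slab)`);
* `Fluid.IsMildNSSolutionOn.integral_inner_sub_slice_eq_slab`: the tested difference identity of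
  `KatoUniquenessPairing.lean` with `φ = Θ(t)`, the contribution of `(0, τ₀]` removed by the
  coincidence hypothesis, rewritten as a slab integral.

## References

* P. G. Lemarié-Rieusset, *The Navier–Stokes problem in the 21st century*, CRC Press 2016,
  Thm. 7.7 and its proof (second and fourth steps), pp. 147–149. [cite: LemarieRieusset2016, Thm. 7.7]
* G. Furioli, P. G. Lemarié-Rieusset, E. Terraneo, *Unicité dans `L³(ℝ³)` et d'autres espaces
  fonctionnels limites pour Navier–Stokes*, Rev. Mat. Iberoam. 16 (2000), Thm. 1.
  [cite: FurioliLemarieRieussetTerraneo2000, Thm. 1]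
* L. C. Evans, *Partial Differential Equations*, 2nd ed., AMS 2010, §2.3.1 (heat kernel).
  [cite: Evans2010, §2.3.1]
-/

noncomputable section

open MeasureTheory TopologicalSpace Set Function Filter Topology InnerProductSpace
open scoped RealInnerProductSpace ENNReal NNReal

namespace Literature.Analysis.FluidPDE

variable {E : Type*} [NormedAddCommGroup E] [InnerProductSpace ℝ E] [FiniteDimensional ℝ E]
  [MeasurableSpace E] [BorelSpace E]

/-! ### Joint continuity of the caloric extension in the data -/

section Param

variable {F : Type*} [NormedAddCommGroup F] [NormedSpace ℝ F]
variable {P : Type*} [TopologicalSpace P] [FirstCountableTopology P]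

/-- **Joint continuity of the scaled caloric integral with a parameter**:
`(p, σ, x) ↦ ∫ G_1(z) • G(p)(x - √σ z) dz` is continuous on `P × ℝ × E` for a jointly continuous,
uniformly bounded family of data `G : P → E → F` (dominated convergence with the fixed majorant
`‖G‖_∞ G_1`; parametric version of `continuous_integral_heatKernel_one_smul`). [folklore] -/
theorem continuous_integral_heatKernel_one_smul_param {G : P → E → F}
    (hG : Continuous (uncurry G)) {C : ℝ} (hC : ∀ p z, ‖G p z‖ ≤ C) :
    Continuous fun q : P × ℝ × E =>
      ∫ z, UnboundedOperators.heatKernel 1 z • G q.1 (q.2.2 - Real.sqrt q.2.1 • z) := by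
  have hK := UnboundedOperators.continuous_heatKernel (E := E) 1
  refine continuous_of_dominated (bound := fun z => UnboundedOperators.heatKernel 1 z * C) ?_ ?_ ?_ ?_
  · intro q
    have hc : Continuous fun z : E => G q.1 (q.2.2 - Real.sqrt q.2.1 • z) :=
      hG.comp (continuous_const.prodMk (continuous_const.sub (continuous_const.smul continuous_id)))
    exact (hK.smul hc).aestronglyMeasurable
  · intro q
    refine Eventually.of_forall fun z => ?_
    rw [norm_smul, Real.norm_of_nonneg (UnboundedOperators.heatKernel_pos one_pos z).le]
    exact mul_le_mul_of_nonneg_left (hC _ _) (UnboundedOperators.heatKernel_pos one_pos z).le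
  · exact (UnboundedOperators.integrable_heatKernel_holds one_pos).mul_const C
  · refine Eventually.of_forall fun z => ?_
    have hc : Continuous fun q : P × ℝ × E => G q.1 (q.2.2 - Real.sqrt q.2.1 • z) :=
      hG.comp (continuous_fst.prodMk ((continuous_snd.comp continuous_snd).sub
        ((Real.continuous_sqrt.comp (continuous_fst.comp continuous_snd)).smul continuous_const)))
    exact continuous_const.smul hc

/-- **Joint continuity of `(p, σ, x) ↦ e^{σΔ} G(p) (x)` on `P × (0, ∞) × E`** for a jointly
continuous, uniformly bounded family of data (parametric version of
`continuousOn_uncurry_heatExtension`). [folklore] -/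
theorem continuousOn_heatExtension_param {G : P → E → F} (hG : Continuous (uncurry G)) {C : ℝ}
    (hC : ∀ p z, ‖G p z‖ ≤ C) :
    ContinuousOn (fun q : P × ℝ × E => UnboundedOperators.heatExtension (G q.1) q.2.1 q.2.2)
      (univ ×ˢ (Ioi 0 ×ˢ univ)) :=
  ((continuous_integral_heatKernel_one_smul_param hG hC).continuousOn).congr fun q hq =>
    UnboundedOperators.heatExtension_eq_integral_heatKernel_one (mem_prod.1 (mem_prod.1 hq).2).1 (G q.1) q.2.2

end Param

/-! ### The transport kernel of a space-time test field -/

section Kernel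

variable {ν : ℝ} {Θ : ℝ → E → E}

/-- **Joint continuity of the transport kernel** `(t, τ, x) ↦ D(e^{ν(t-τ)Δ}Θ(t))(x)` on
`{τ < t}`, for a space-time test field `Θ` (the derivative falls on `Θ(t)`, and
`continuousOn_heatExtension_param`). [folklore] -/
theorem IsSpaceTimeTestOn.continuousOn_fderiv_heatTest_param
    (hΘ : IsSpaceTimeTestOn (⊤ : Opens (ℝ × E)) Θ) (hν : 0 < ν) :
    ContinuousOn (fun q : ℝ × ℝ × E => fderiv ℝ (heatTest ν (Θ q.1) (q.1 - q.2.1)) q.2.2)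
      {q | q.2.1 < q.1} := by
  have hΘ' : IsSpaceTimeTestOn (⊤ : Opens (ℝ × E)) (fun t y => fderiv ℝ (Θ t) y) := hΘ.fderiv_top
  obtain ⟨M, hM0, hM⟩ := hΘ'.exists_norm_le
  have hcont := continuousOn_heatExtension_param (P := ℝ) hΘ'.continuous_uncurry hM
  have hc2 : Continuous fun q : ℝ × ℝ × E => ((q.1, ν * (q.1 - q.2.1), q.2.2) : ℝ × ℝ × E) := by
    fun_prop
  have h := ContinuousOn.comp (g := fun q : ℝ × ℝ × E => UnboundedOperators.heatExtension (fun y => fderiv ℝ (Θ q.1) y) q.2.1 q.2.2)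
    (f := fun q : ℝ × ℝ × E => ((q.1, ν * (q.1 - q.2.1), q.2.2) : ℝ × ℝ × E))
    (s := {q | q.2.1 < q.1}) hcont hc2.continuousOn
    (fun q hq => ⟨mem_univ _, mul_pos hν (sub_pos.2 hq), mem_univ _⟩)
  refine h.congr fun q hq => ?_
  simp only [Function.comp_def]
  exact fderiv_heatTest_of_pos hν (sub_pos.2 hq) (contDiff_infty.1 (hΘ.contDiff_slice q.1) 1)
    (hΘ.hasCompactSupport_slice q.1) q.2.2

end Kernel

/-! ### Trilinear bounds with general exponents -/

section Trilinear

/-- **Three-factor Hölder bound of the transport integrand** `⟪a, Ψ b⟫` with real exponents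
`p, q, r > 0`, `1/p + 1/q + 1/r = 1`: `∫ |⟪a, Ψ b⟫| ≤ ‖a‖_p ‖Ψ‖_q ‖b‖_r` (`lintegral` form).
[folklore] -/
theorem lintegral_enorm_inner_clm_apply_le {a b : E → E} {Ψ : E → E →L[ℝ] E}
    (ha : AEStronglyMeasurable a (volume : Measure E))
    (hb : AEStronglyMeasurable b (volume : Measure E))
    (hΨ : AEStronglyMeasurable Ψ (volume : Measure E)) {p q r : ℝ} (hp : 0 < p) (hq : 0 < q)
    (hr : 0 < r) (hpqr : 1 / p + 1 / q + 1 / r = 1) :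
    ∫⁻ x, ‖⟪a x, Ψ x (b x)⟫‖ₑ ≤
      eLpNorm a (ENNReal.ofReal p) volume * eLpNorm Ψ (ENNReal.ofReal q) volume *
        eLpNorm b (ENNReal.ofReal r) volume := by
  have hpt : ∀ x, ‖⟪a x, Ψ x (b x)⟫‖ₑ ≤ ‖a x‖ₑ * ‖Ψ x‖ₑ * ‖b x‖ₑ := fun x => by
    have h : ‖⟪a x, Ψ x (b x)⟫‖ ≤ ‖a x‖ * ‖Ψ x‖ * ‖b x‖ := by
      calc ‖⟪a x, Ψ x (b x)⟫‖ ≤ ‖a x‖ * ‖Ψ x (b x)‖ := norm_inner_le_norm _ _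
        _ ≤ ‖a x‖ * (‖Ψ x‖ * ‖b x‖) :=
            mul_le_mul_of_nonneg_left (ContinuousLinearMap.le_opNorm _ _) (norm_nonneg _)
        _ = ‖a x‖ * ‖Ψ x‖ * ‖b x‖ := by ring
    calc ‖⟪a x, Ψ x (b x)⟫‖ₑ = ENNReal.ofReal ‖⟪a x, Ψ x (b x)⟫‖ := (ofReal_norm _).symm
      _ ≤ ENNReal.ofReal (‖a x‖ * ‖Ψ x‖ * ‖b x‖) := ENNReal.ofReal_le_ofReal h
      _ = ‖a x‖ₑ * ‖Ψ x‖ₑ * ‖b x‖ₑ := by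
          rw [ENNReal.ofReal_mul (by positivity), ENNReal.ofReal_mul (by positivity),
            ofReal_norm, ofReal_norm, ofReal_norm]
  exact (lintegral_mono fun x => hpt x).trans
    (lintegral_enorm_mul_mul_le (μ := (volume : Measure E)) ha hΨ hb hp hq hr hpqr)

/-- `L¹` form of the trilinear bound in `L³ × L³ × L³`:
`∫ ‖⟪a, Ψ b⟫‖ ≤ ‖a‖_{L³} ‖Ψ‖_{L³} ‖b‖_{L³}`. [folklore] -/
theorem integral_norm_inner_clm_apply_le {a b : E → E} {Ψ : E → E →L[ℝ] E}
    (ha : MemLp a 3 (volume : Measure E)) (hb : MemLp b 3 (volume : Measure E))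
    (hΨ : MemLp Ψ 3 (volume : Measure E)) :
    ∫ x, ‖⟪a x, Ψ x (b x)⟫‖ ≤
      (eLpNorm a 3 volume * eLpNorm Ψ 3 volume * eLpNorm b 3 volume).toReal := by
  have hmeas : AEStronglyMeasurable (fun x => ⟪a x, Ψ x (b x)⟫) volume :=
    ha.1.inner ((isBoundedBilinearMap_apply (𝕜 := ℝ) (E := E) (F := E)).continuous
      |>.comp_aestronglyMeasurable (hΨ.1.prodMk hb.1))
  have h3 : ENNReal.ofReal (3 : ℝ) = 3 := by norm_num
  have hH := lintegral_enorm_inner_clm_apply_le ha.1 hb.1 hΨ.1 (p := 3) (q := 3) (r := 3)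
    (by norm_num) (by norm_num) (by norm_num) (by norm_num)
  rw [h3] at hH
  rw [integral_norm_eq_lintegral_enorm hmeas]
  exact ENNReal.toReal_mono (ENNReal.mul_lt_top (ENNReal.mul_lt_top ha.2 hΨ.2) hb.2).ne hH

end Trilinear

/-! ### The transport kernel: bounds, measurability, time integral -/

section KernelBounds

variable {ν : ℝ} {Θ : ℝ → E → E}

omit [FiniteDimensional ℝ E] [MeasurableSpace E] [BorelSpace E] in
/-- Time slices of a space-time test field on `ℝ × E` are test fields on `E`. [folklore] -/
theorem IsSpaceTimeTestOn.isTestFunctionOn_slice {F : Type*} [NormedAddCommGroup F]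
    [NormedSpace ℝ F] {Θ : ℝ → E → F} (hΘ : IsSpaceTimeTestOn (⊤ : Opens (ℝ × E)) Θ) (t : ℝ) :
    FunctionSpaces.IsTestFunctionOn (⊤ : Opens E) (Θ t) :=
  { contDiff := hΘ.contDiff_slice t
    hasCompactSupport := hΘ.hasCompactSupport_slice t
    tsupport_subset := fun _ _ => trivial }

/-- **Uniform `L³` bound of the gradients of the slices** of a space-time test field:
`‖DΘ(t)‖_{L³} ≤ R < ∞` for all `t` (the gradients are bounded by `‖DΘ‖_∞` and supported in a
fixed compact set). [folklore] -/
theorem IsSpaceTimeTestOn.exists_eLpNorm_fderiv_slice_le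
    (hΘ : IsSpaceTimeTestOn (⊤ : Opens (ℝ × E)) Θ) :
    ∃ R : ℝ≥0∞, R < ⊤ ∧ ∀ t, eLpNorm (fun y => fderiv ℝ (Θ t) y) 3 (volume : Measure E) ≤ R := by
  obtain ⟨M₁, hM₁0, hM₁⟩ := hΘ.fderiv_top.exists_norm_le
  obtain ⟨K, hK, hKt⟩ := hΘ.exists_compact_slice_subset
  refine ⟨eLpNorm (K.indicator fun _ => (M₁ : ℝ)) 3 (volume : Measure E), ?_, fun t => ?_⟩
  · rw [eLpNorm_indicator_const hK.measurableSet (by norm_num) (by norm_num)]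
    exact ENNReal.mul_lt_top (by simp) (ENNReal.rpow_lt_top_of_nonneg (by norm_num)
      hK.measure_lt_top.ne)
  · refine eLpNorm_mono fun y => ?_
    by_cases hy : y ∈ K
    · rw [indicator_of_mem hy, Real.norm_of_nonneg hM₁0]
      exact hM₁ t y
    · have h0 : fderiv ℝ (Θ t) y = 0 := by
        by_contra h
        exact hy (hKt t (support_fderiv_subset ℝ (mem_support.2 h)))
      rw [h0, norm_zero]
      exact norm_nonneg _

/-- **Pointwise bound of the transport kernel**: `‖1_{τ<t} D(e^{ν(t-τ)Δ}Θ(t))(x)‖ ≤ ‖DΘ‖_∞`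
(maximum principle `norm_heatExtension_le`). [folklore] -/
theorem IsSpaceTimeTestOn.norm_transportKernel_le
    (hΘ : IsSpaceTimeTestOn (⊤ : Opens (ℝ × E)) Θ) (hν : 0 < ν) {M₁ : ℝ}
    (hM₁0 : 0 ≤ M₁) (hM₁ : ∀ t y, ‖fderiv ℝ (Θ t) y‖ ≤ M₁) (t τ : ℝ) (x : E) :
    ‖(if τ < t then fderiv ℝ (heatTest ν (Θ t) (t - τ)) x else 0)‖ ≤ M₁ := by
  split_ifs with h
  · rw [fderiv_heatTest_of_pos hν (sub_pos.2 h) (contDiff_infty.1 (hΘ.contDiff_slice t) 1)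
      (hΘ.hasCompactSupport_slice t) x]
    exact UnboundedOperators.norm_heatExtension_le (hM₁ t) (mul_pos hν (sub_pos.2 h)) x
  · rw [norm_zero]
    exact hM₁0

/-- The transport kernel slice `x ↦ 1_{τ<t} D(e^{ν(t-τ)Δ}Θ(t))(x)` is in `L³` with
`‖·‖_{L³} ≤ ‖DΘ(t)‖_{L³}`. [folklore] -/
theorem IsSpaceTimeTestOn.memLp_transportKernel
    (hΘ : IsSpaceTimeTestOn (⊤ : Opens (ℝ × E)) Θ) (hν : 0 < ν) (t τ : ℝ) :
    MemLp (fun x => if τ < t then fderiv ℝ (heatTest ν (Θ t) (t - τ)) x else 0) 3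
        (volume : Measure E) ∧
      eLpNorm (fun x => if τ < t then fderiv ℝ (heatTest ν (Θ t) (t - τ)) x else 0) 3 volume ≤
        eLpNorm (fun y => fderiv ℝ (Θ t) y) 3 volume := by
  by_cases h : τ < t
  · simp only [if_pos h]
    exact ⟨memLp_fderiv_heatTest hν (sub_pos.2 h).le (contDiff_infty.1 (hΘ.contDiff_slice t) 1)
        (hΘ.hasCompactSupport_slice t) (by norm_num),
      eLpNorm_fderiv_heatTest_le hν (sub_pos.2 h).le (contDiff_infty.1 (hΘ.contDiff_slice t) 1)
        (hΘ.hasCompactSupport_slice t) (by norm_num)⟩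
  · simp only [if_neg h]
    exact ⟨MemLp.zero' , by simp⟩

/-- **Joint measurability of the transport kernel** `(t, τ, x) ↦ 1_{τ<t} D(e^{ν(t-τ)Δ}Θ(t))(x)`
with respect to any measure on `ℝ × ℝ × E` (continuous on the measurable set `{τ < t}`).
[folklore] -/
theorem IsSpaceTimeTestOn.aestronglyMeasurable_transportKernel
    (hΘ : IsSpaceTimeTestOn (⊤ : Opens (ℝ × E)) Θ) (hν : 0 < ν) (μ : Measure (ℝ × ℝ × E)) :
    AEStronglyMeasurable (fun q : ℝ × ℝ × E =>
      if q.2.1 < q.1 then fderiv ℝ (heatTest ν (Θ q.1) (q.1 - q.2.1)) q.2.2 else 0) μ := by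
  have hS : MeasurableSet {q : ℝ × ℝ × E | q.2.1 < q.1} :=
    measurableSet_lt measurable_snd.fst measurable_fst
  have heq : (fun q : ℝ × ℝ × E =>
      if q.2.1 < q.1 then fderiv ℝ (heatTest ν (Θ q.1) (q.1 - q.2.1)) q.2.2 else 0) =
      {q : ℝ × ℝ × E | q.2.1 < q.1}.indicator
        (fun q => fderiv ℝ (heatTest ν (Θ q.1) (q.1 - q.2.1)) q.2.2) := by
    funext q
    by_cases h : q.2.1 < q.1 <;> simp [h]
  rw [heq, aestronglyMeasurable_indicator_iff hS]
  exact (hΘ.continuousOn_fderiv_heatTest_param hν).aestronglyMeasurable hS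

/-- **Measurability of a time-slice of the transport kernel** `(τ, x) ↦ 1_{τ<t} D(e^{ν(t-τ)Δ}Θ(t))(x)`
for fixed `t`, with respect to any measure on `ℝ × E`. [folklore] -/
theorem IsSpaceTimeTestOn.aestronglyMeasurable_transportKernel_slice
    (hΘ : IsSpaceTimeTestOn (⊤ : Opens (ℝ × E)) Θ) (hν : 0 < ν) (t : ℝ) (ρ : Measure (ℝ × E)) :
    AEStronglyMeasurable (fun y : ℝ × E =>
      if y.1 < t then fderiv ℝ (heatTest ν (Θ t) (t - y.1)) y.2 else 0) ρ := by
  have hS : MeasurableSet {y : ℝ × E | y.1 < t} := measurableSet_lt measurable_fst measurable_const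
  have heq : (fun y : ℝ × E => if y.1 < t then fderiv ℝ (heatTest ν (Θ t) (t - y.1)) y.2 else 0) =
      {y : ℝ × E | y.1 < t}.indicator (fun y => fderiv ℝ (heatTest ν (Θ t) (t - y.1)) y.2) := by
    funext y
    by_cases h : y.1 < t <;> simp [h]
  rw [heq, aestronglyMeasurable_indicator_iff hS]
  have hc2 : Continuous fun y : ℝ × E => ((t, y) : ℝ × ℝ × E) := by fun_prop
  have h := ContinuousOn.comp (g := fun q : ℝ × ℝ × E =>
      fderiv ℝ (heatTest ν (Θ q.1) (q.1 - q.2.1)) q.2.2)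
    (f := fun y : ℝ × E => ((t, y) : ℝ × ℝ × E)) (s := {y : ℝ × E | y.1 < t})
    (hΘ.continuousOn_fderiv_heatTest_param hν) hc2.continuousOn (fun y hy => hy)
  exact (show ContinuousOn (fun y : ℝ × E => fderiv ℝ (heatTest ν (Θ t) (t - y.1)) y.2)
    {y : ℝ × E | y.1 < t} by simpa only [Function.comp_def] using h).aestronglyMeasurable hS

/-- **Integrability in `t` of the transport kernel** on a bounded time interval, for fixed
`(τ, x)` (bounded by `‖DΘ‖_∞`, continuous on `t > τ`). [folklore] -/
theorem IsSpaceTimeTestOn.integrableOn_transportKernel_time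
    (hΘ : IsSpaceTimeTestOn (⊤ : Opens (ℝ × E)) Θ) (hν : 0 < ν) (τ₀ τ₁ τ : ℝ) (x : E) :
    IntegrableOn (fun t => if τ < t then fderiv ℝ (heatTest ν (Θ t) (t - τ)) x else 0)
      (Ioc τ₀ τ₁) volume := by
  obtain ⟨M₁, hM₁0, hM₁⟩ := hΘ.fderiv_top.exists_norm_le
  have hS : MeasurableSet {t : ℝ | τ < t} := measurableSet_lt measurable_const measurable_id
  have heq : (fun t => if τ < t then fderiv ℝ (heatTest ν (Θ t) (t - τ)) x else 0) =
      {t : ℝ | τ < t}.indicator (fun t => fderiv ℝ (heatTest ν (Θ t) (t - τ)) x) := by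
    funext t
    by_cases h : τ < t <;> simp [h]
  have hmeas : AEStronglyMeasurable
      (fun t => if τ < t then fderiv ℝ (heatTest ν (Θ t) (t - τ)) x else 0)
      (volume.restrict (Ioc τ₀ τ₁)) := by
    rw [heq, aestronglyMeasurable_indicator_iff hS, Measure.restrict_restrict hS]
    have hc2 : Continuous fun t : ℝ => ((t, τ, x) : ℝ × ℝ × E) := by fun_prop
    have h := ContinuousOn.comp (g := fun q : ℝ × ℝ × E =>
        fderiv ℝ (heatTest ν (Θ q.1) (q.1 - q.2.1)) q.2.2)
      (f := fun t : ℝ => ((t, τ, x) : ℝ × ℝ × E)) (s := {t : ℝ | τ < t})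
      (hΘ.continuousOn_fderiv_heatTest_param hν) hc2.continuousOn (fun t ht => ht)
    have h' : ContinuousOn (fun t => fderiv ℝ (heatTest ν (Θ t) (t - τ)) x) {t : ℝ | τ < t} := by
      simpa only [Function.comp_def] using h
    exact (h'.aestronglyMeasurable hS).mono_measure
      (Measure.restrict_mono inter_subset_left le_rfl)
  haveI : IsFiniteMeasure (volume.restrict (Ioc τ₀ τ₁)) :=
    isFiniteMeasure_restrict.2 measure_Ioc_lt_top.ne
  refine Integrable.mono' (integrable_const M₁) hmeas (Eventually.of_forall fun t => ?_)
  exact hΘ.norm_transportKernel_le hν hM₁0 (fun t y => hM₁ t y) t τ x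

/-- **Time integral of the transport kernel = gradient of the dual field**: for a space-time test
field `Θ` with time support in `[a, b]`, `b ≤ τ₁`, and `τ ∈ [τ₀, τ₁]`,
`∫_{t ∈ (τ₀, τ₁]} 1_{τ<t} D(e^{ν(t-τ)Δ}Θ(t))(x) dt = D(𝒰[Θ](τ))(x)`, `𝒰[Θ] = heatDuhamelBack ν Θ`
(substitute `t = τ + σ`; the derivative falls on the data, `fderiv_heatDuhamelBack`). This is
the kernel identity behind `∫⟨B(u,v), Θ⟩ dt = ∫⟨u ⊗ v, ∇𝒰[Θ]⟩ dτ` (Lemarié-Rieusset 2016,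
proof of Thm. 7.7, fourth step, p. 149). [cite: LemarieRieusset2016, proof of Thm. 7.7, fourth step, p. 149] -/
theorem IsSpaceTimeTestOn.setIntegral_transportKernel_eq_fderiv_heatDuhamelBack
    (hΘ : IsSpaceTimeTestOn (⊤ : Opens (ℝ × E)) Θ) (hν : 0 < ν) {a b τ₀ τ₁ : ℝ}
    (hab : ∀ t, t ∉ Icc a b → Θ t = 0) (hb : b ≤ τ₁) {τ : ℝ} (hτ : τ ∈ Icc τ₀ τ₁) (x : E) :
    ∫ t in Ioc τ₀ τ₁, (if τ < t then fderiv ℝ (heatTest ν (Θ t) (t - τ)) x else 0) =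
      fderiv ℝ (heatDuhamelBack ν Θ τ) x := by
  have hΘ' : IsSpaceTimeTestOn (⊤ : Opens (ℝ × E)) (fun t y => fderiv ℝ (Θ t) y) := hΘ.fderiv_top
  have hab' : ∀ t, t ∉ Icc a b → (fun t y => fderiv ℝ (Θ t) y) t = 0 := fun t ht =>
    fderiv_slice_eq_zero_of_eq_zero (hab t ht)
  -- restrict to `t > τ`
  have heq : (fun t => if τ < t then fderiv ℝ (heatTest ν (Θ t) (t - τ)) x else 0) =
      (Ioi τ).indicator (fun t => fderiv ℝ (heatTest ν (Θ t) (t - τ)) x) := by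
    funext t
    by_cases h : τ < t <;> simp [h]
  rw [heq, setIntegral_indicator measurableSet_Ioi]
  have hset : Ioc τ₀ τ₁ ∩ Ioi τ = Ioc τ τ₁ := by
    ext t
    simp only [mem_inter_iff, mem_Ioc, mem_Ioi]
    constructor
    · rintro ⟨⟨-, h2⟩, h3⟩; exact ⟨h3, h2⟩
    · rintro ⟨h1, h2⟩; exact ⟨⟨hτ.1.trans_lt h1, h2⟩, h1⟩
  rw [hset]
  -- on `t > τ` the derivative falls on the data
  have hcongr : ∀ t ∈ Ioc τ τ₁, fderiv ℝ (heatTest ν (Θ t) (t - τ)) x =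
      UnboundedOperators.heatExtension (fun y => fderiv ℝ (Θ ((t - τ) + τ)) y) (ν * (t - τ)) x := fun t ht => by
    rw [sub_add_cancel]
    exact fderiv_heatTest_of_pos hν (sub_pos.2 ht.1) (contDiff_infty.1 (hΘ.contDiff_slice t) 1)
      (hΘ.hasCompactSupport_slice t) x
  rw [setIntegral_congr_fun measurableSet_Ioc hcongr, ← intervalIntegral.integral_of_le hτ.2,
    intervalIntegral.integral_comp_sub_right
      (fun σ => UnboundedOperators.heatExtension (fun y => fderiv ℝ (Θ (σ + τ)) y) (ν * σ) x) τ,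
    sub_self, intervalIntegral.integral_of_le (sub_nonneg.2 hτ.2),
    congrFun (hΘ.fderiv_heatDuhamelBack hν τ) x,
    hΘ'.heatDuhamelBack_eq_setIntegral_Ioc hν hab' (sub_nonneg.2 hτ.2) (by linarith) x]
  refine setIntegral_congr_fun measurableSet_Ioc fun σ _ => ?_
  rw [add_comm σ τ]

end KernelBounds


/-! ### Fubini bookkeeping on the slab for a general transport kernel -/

section SlabFubini

variable {K : ℝ → ℝ × E → E →L[ℝ] E} {a b : ℝ → E → E} {τ₀ τ₁ : ℝ} {M : ℝ≥0} {R : ℝ≥0∞}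

/-- **`x`-integrability of the transport integrand** `⟪a, K a⟫ - ⟪b, K b⟫` at fixed times, with the
`L¹` bound `2 M² R` from the `L³` bounds `M` of `a(τ), b(τ)` and `R` of the kernel slice.
[folklore] -/
theorem integrable_transportIntegrand_space
    (hK3 : ∀ t τ, MemLp (fun x => K t (τ, x)) 3 (volume : Measure E) ∧
      eLpNorm (fun x => K t (τ, x)) 3 volume ≤ R) (hR : R < ⊤) {t τ : ℝ}
    (ha : MemLp (a τ) 3 (volume : Measure E)) (hb : MemLp (b τ) 3 (volume : Measure E))
    (haM : eLpNorm (a τ) 3 volume ≤ M) (hbM : eLpNorm (b τ) 3 volume ≤ M) :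
    Integrable (fun x => ⟪a τ x, K t (τ, x) (a τ x)⟫ - ⟪b τ x, K t (τ, x) (b τ x)⟫) volume ∧
      ∫ x, ‖⟪a τ x, K t (τ, x) (a τ x)⟫ - ⟪b τ x, K t (τ, x) (b τ x)⟫‖ ≤
        2 * (M : ℝ) ^ 2 * R.toReal := by
  have hΨ := (hK3 t τ).1
  have i1 := (integral_inner_clm_apply_le ha ha hΨ).1
  have i2 := (integral_inner_clm_apply_le hb hb hΨ).1
  have n1 := integral_norm_inner_clm_apply_le ha ha hΨ
  have n2 := integral_norm_inner_clm_apply_le hb hb hΨ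
  refine ⟨i1.sub i2, ?_⟩
  have hRM : ∀ {c : E → E}, eLpNorm c 3 (volume : Measure E) ≤ M →
      (eLpNorm c 3 volume * eLpNorm (fun x => K t (τ, x)) 3 volume * eLpNorm c 3 volume).toReal ≤
        M * R.toReal * M := by
    intro c hc
    have h : eLpNorm c 3 volume * eLpNorm (fun x => K t (τ, x)) 3 volume * eLpNorm c 3 volume ≤
        M * R * M := by
      gcongr
      · exact (hK3 t τ).2
    have hfin : (M : ℝ≥0∞) * R * M ≠ ⊤ :=
      ENNReal.mul_ne_top (ENNReal.mul_ne_top ENNReal.coe_ne_top hR.ne) ENNReal.coe_ne_top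
    have := ENNReal.toReal_mono hfin h
    simp only [ENNReal.toReal_mul, ENNReal.coe_toReal] at this ⊢
    exact this
  calc ∫ x, ‖⟪a τ x, K t (τ, x) (a τ x)⟫ - ⟪b τ x, K t (τ, x) (b τ x)⟫‖
      ≤ ∫ x, (‖⟪a τ x, K t (τ, x) (a τ x)⟫‖ + ‖⟪b τ x, K t (τ, x) (b τ x)⟫‖) :=
        integral_mono (i1.sub i2).norm (i1.norm.add i2.norm) fun x => norm_sub_le _ _
    _ = (∫ x, ‖⟪a τ x, K t (τ, x) (a τ x)⟫‖) + ∫ x, ‖⟪b τ x, K t (τ, x) (b τ x)⟫‖ :=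
        integral_add i1.norm i2.norm
    _ ≤ M * R.toReal * M + M * R.toReal * M := add_le_add (n1.trans (hRM haM)) (n2.trans (hRM hbM))
    _ = 2 * (M : ℝ) ^ 2 * R.toReal := by ring

omit [FiniteDimensional ℝ E] [BorelSpace E] in
/-- Measurability of a time slice of the transport integrand on `ℝ × E`. [folklore] -/
theorem aestronglyMeasurable_transportIntegrand_slice {ρ : Measure (ℝ × E)} {t : ℝ}
    (hKt : AEStronglyMeasurable (K t) ρ) (ha : AEStronglyMeasurable (uncurry a) ρ)
    (hb : AEStronglyMeasurable (uncurry b) ρ) :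
    AEStronglyMeasurable
      (fun y : ℝ × E => ⟪a y.1 y.2, K t y (a y.1 y.2)⟫ - ⟪b y.1 y.2, K t y (b y.1 y.2)⟫) ρ := by
  have happ := (isBoundedBilinearMap_apply (𝕜 := ℝ) (E := E) (F := E)).continuous
  exact (ha.inner (happ.comp_aestronglyMeasurable (hKt.prodMk ha))).sub
    (hb.inner (happ.comp_aestronglyMeasurable (hKt.prodMk hb)))

omit [FiniteDimensional ℝ E] [BorelSpace E] in
/-- Joint measurability of the transport integrand on `ℝ × (ℝ × E)`. [folklore] -/
theorem aestronglyMeasurable_transportIntegrand {μ : Measure ℝ} {ρ : Measure (ℝ × E)} [SFinite ρ]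
    (hK : AEStronglyMeasurable (uncurry K) (μ.prod ρ)) (ha : AEStronglyMeasurable (uncurry a) ρ)
    (hb : AEStronglyMeasurable (uncurry b) ρ) :
    AEStronglyMeasurable (fun q : ℝ × (ℝ × E) =>
      ⟪a q.2.1 q.2.2, K q.1 q.2 (a q.2.1 q.2.2)⟫ - ⟪b q.2.1 q.2.2, K q.1 q.2 (b q.2.1 q.2.2)⟫)
      (μ.prod ρ) := by
  have happ := (isBoundedBilinearMap_apply (𝕜 := ℝ) (E := E) (F := E)).continuous
  have ha' : AEStronglyMeasurable (fun q : ℝ × (ℝ × E) => uncurry a q.2) (μ.prod ρ) := ha.comp_snd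
  have hb' : AEStronglyMeasurable (fun q : ℝ × (ℝ × E) => uncurry b q.2) (μ.prod ρ) := hb.comp_snd
  exact (ha'.inner (happ.comp_aestronglyMeasurable (hK.prodMk ha'))).sub
    (hb'.inner (happ.comp_aestronglyMeasurable (hK.prodMk hb')))

/-- **Integrability of a time slice of the transport integrand on the slab**
`(τ₀, τ₁] × E`, with `L¹` bound `2 M² R (τ₁ - τ₀)`. [folklore] -/
theorem integrable_transportIntegrand_slab (hτ : τ₀ ≤ τ₁)
    (hK3 : ∀ t τ, MemLp (fun x => K t (τ, x)) 3 (volume : Measure E) ∧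
      eLpNorm (fun x => K t (τ, x)) 3 volume ≤ R) (hR : R < ⊤) {t : ℝ}
    (hKt : AEStronglyMeasurable (K t) ((volume.restrict (Ioc τ₀ τ₁)).prod (volume : Measure E)))
    (ha : AEStronglyMeasurable (uncurry a) ((volume.restrict (Ioc τ₀ τ₁)).prod (volume : Measure E)))
    (hb : AEStronglyMeasurable (uncurry b) ((volume.restrict (Ioc τ₀ τ₁)).prod (volume : Measure E)))
    (ha3 : ∀ τ ∈ Icc τ₀ τ₁, MemLp (a τ) 3 (volume : Measure E) ∧ eLpNorm (a τ) 3 volume ≤ M)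
    (hb3 : ∀ τ ∈ Icc τ₀ τ₁, MemLp (b τ) 3 (volume : Measure E) ∧ eLpNorm (b τ) 3 volume ≤ M) :
    Integrable (fun y : ℝ × E => ⟪a y.1 y.2, K t y (a y.1 y.2)⟫ - ⟪b y.1 y.2, K t y (b y.1 y.2)⟫)
        ((volume.restrict (Ioc τ₀ τ₁)).prod (volume : Measure E)) ∧
      ∫ y, ‖⟪a y.1 y.2, K t y (a y.1 y.2)⟫ - ⟪b y.1 y.2, K t y (b y.1 y.2)⟫‖
          ∂((volume.restrict (Ioc τ₀ τ₁)).prod (volume : Measure E)) ≤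
        2 * (M : ℝ) ^ 2 * R.toReal * (τ₁ - τ₀) := by
  haveI : IsFiniteMeasure (volume.restrict (Ioc τ₀ τ₁)) :=
    isFiniteMeasure_restrict.2 measure_Ioc_lt_top.ne
  have hmeas := aestronglyMeasurable_transportIntegrand_slice hKt ha hb
  have hsl : ∀ τ ∈ Icc τ₀ τ₁,
      Integrable (fun x => ⟪a τ x, K t (τ, x) (a τ x)⟫ - ⟪b τ x, K t (τ, x) (b τ x)⟫) volume ∧
        ∫ x, ‖⟪a τ x, K t (τ, x) (a τ x)⟫ - ⟪b τ x, K t (τ, x) (b τ x)⟫‖ ≤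
          2 * (M : ℝ) ^ 2 * R.toReal := fun τ hτ' =>
    integrable_transportIntegrand_space hK3 hR (ha3 τ hτ').1 (hb3 τ hτ').1 (ha3 τ hτ').2 (hb3 τ hτ').2
  have hint : Integrable
      (fun y : ℝ × E => ⟪a y.1 y.2, K t y (a y.1 y.2)⟫ - ⟪b y.1 y.2, K t y (b y.1 y.2)⟫)
      ((volume.restrict (Ioc τ₀ τ₁)).prod (volume : Measure E)) := by
    rw [integrable_prod_iff hmeas]
    constructor
    · refine (ae_restrict_iff' measurableSet_Ioc).2 (Eventually.of_forall fun τ hτ' => ?_)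
      exact (hsl τ (Ioc_subset_Icc_self hτ')).1
    · refine Integrable.mono' (integrable_const (2 * (M : ℝ) ^ 2 * R.toReal))
        hmeas.norm.integral_prod_right' ?_
      refine (ae_restrict_iff' measurableSet_Ioc).2 (Eventually.of_forall fun τ hτ' => ?_)
      rw [Real.norm_of_nonneg (integral_nonneg fun _ => norm_nonneg _)]
      exact (hsl τ (Ioc_subset_Icc_self hτ')).2
  refine ⟨hint, ?_⟩
  rw [integral_prod _ hint.norm]
  calc ∫ τ in Ioc τ₀ τ₁, ∫ x, ‖⟪a τ x, K t (τ, x) (a τ x)⟫ - ⟪b τ x, K t (τ, x) (b τ x)⟫‖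
      ≤ ∫ τ in Ioc τ₀ τ₁, 2 * (M : ℝ) ^ 2 * R.toReal := by
        refine setIntegral_mono_on hint.norm.integral_prod_left
          (integrableOn_const measure_Ioc_lt_top.ne)
          measurableSet_Ioc fun τ hτ' => ?_
        exact (hsl τ (Ioc_subset_Icc_self hτ')).2
    _ = 2 * (M : ℝ) ^ 2 * R.toReal * (τ₁ - τ₀) := by
        rw [setIntegral_const, Real.volume_real_Ioc_of_le hτ, smul_eq_mul]; ring

end SlabFubini


section SlabFubini2

variable {K : ℝ → ℝ × E → E →L[ℝ] E} {a b : ℝ → E → E} {τ₀ τ₁ : ℝ} {M : ℝ≥0} {R : ℝ≥0∞}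

/-- **Integrability of the transport integrand on `(τ₀, τ₁] × ((τ₀, τ₁] × E)`** (bounded slab
integrals, joint measurability). [folklore] -/
theorem integrable_transportIntegrand (hτ : τ₀ ≤ τ₁)
    (hK3 : ∀ t τ, MemLp (fun x => K t (τ, x)) 3 (volume : Measure E) ∧
      eLpNorm (fun x => K t (τ, x)) 3 volume ≤ R) (hR : R < ⊤)
    (hK : AEStronglyMeasurable (uncurry K) ((volume.restrict (Ioc τ₀ τ₁)).prod
      ((volume.restrict (Ioc τ₀ τ₁)).prod (volume : Measure E))))
    (hKt : ∀ t, AEStronglyMeasurable (K t) ((volume.restrict (Ioc τ₀ τ₁)).prod (volume : Measure E)))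
    (ha : AEStronglyMeasurable (uncurry a) ((volume.restrict (Ioc τ₀ τ₁)).prod (volume : Measure E)))
    (hb : AEStronglyMeasurable (uncurry b) ((volume.restrict (Ioc τ₀ τ₁)).prod (volume : Measure E)))
    (ha3 : ∀ τ ∈ Icc τ₀ τ₁, MemLp (a τ) 3 (volume : Measure E) ∧ eLpNorm (a τ) 3 volume ≤ M)
    (hb3 : ∀ τ ∈ Icc τ₀ τ₁, MemLp (b τ) 3 (volume : Measure E) ∧ eLpNorm (b τ) 3 volume ≤ M) :
    Integrable (fun q : ℝ × (ℝ × E) =>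
        ⟪a q.2.1 q.2.2, K q.1 q.2 (a q.2.1 q.2.2)⟫ - ⟪b q.2.1 q.2.2, K q.1 q.2 (b q.2.1 q.2.2)⟫)
      ((volume.restrict (Ioc τ₀ τ₁)).prod
        ((volume.restrict (Ioc τ₀ τ₁)).prod (volume : Measure E))) := by
  haveI : IsFiniteMeasure (volume.restrict (Ioc τ₀ τ₁)) :=
    isFiniteMeasure_restrict.2 measure_Ioc_lt_top.ne
  have hmeas := aestronglyMeasurable_transportIntegrand hK ha hb
  have hsl := fun t => integrable_transportIntegrand_slab hτ hK3 hR (hKt t) ha hb ha3 hb3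
  rw [integrable_prod_iff hmeas]
  refine ⟨Eventually.of_forall fun t => (hsl t).1, ?_⟩
  refine Integrable.mono' (integrable_const (2 * (M : ℝ) ^ 2 * R.toReal * (τ₁ - τ₀)))
    hmeas.norm.integral_prod_right' (Eventually.of_forall fun t => ?_)
  rw [Real.norm_of_nonneg (integral_nonneg fun _ => norm_nonneg _)]
  exact (hsl t).2

/-- **Abstract slab duality.** Let `K` be a transport kernel on `(τ₀, τ₁] × ((τ₀, τ₁] × E)` with
uniformly `L³`-bounded, measurable slices, `a, b` jointly measurable fields bounded in `L³`,
and suppose: (i) for every `t ∈ (τ₀, τ₁]` the tested difference `∫⟪a(t) - b(t), Φ(t)⟫` equals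
the slab integral of the transport integrand `⟪a, K_t a⟫ - ⟪b, K_t b⟫`; (ii) for every
`(τ, x)` with `τ ∈ (τ₀, τ₁]`, `t ↦ K_t(τ, x)` is integrable on `(τ₀, τ₁]` with integral
`D(τ)(x)`. Then `∫_{(τ₀,τ₁]} ∫⟪a(t) - b(t), Φ(t)⟫ dt = ∫_{(τ₀,τ₁]} ∫ (⟪a, D a⟫ - ⟪b, D b⟫) dτ`
(Fubini on the slab twice, and the time integral moved inside the continuous bilinear pairing).
[folklore] -/
theorem setIntegral_slab_duality (hτ : τ₀ ≤ τ₁)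
    (hK3 : ∀ t τ, MemLp (fun x => K t (τ, x)) 3 (volume : Measure E) ∧
      eLpNorm (fun x => K t (τ, x)) 3 volume ≤ R) (hR : R < ⊤)
    (hK : AEStronglyMeasurable (uncurry K) ((volume.restrict (Ioc τ₀ τ₁)).prod
      ((volume.restrict (Ioc τ₀ τ₁)).prod (volume : Measure E))))
    (hKt : ∀ t, AEStronglyMeasurable (K t) ((volume.restrict (Ioc τ₀ τ₁)).prod (volume : Measure E)))
    (ha : AEStronglyMeasurable (uncurry a) ((volume.restrict (Ioc τ₀ τ₁)).prod (volume : Measure E)))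
    (hb : AEStronglyMeasurable (uncurry b) ((volume.restrict (Ioc τ₀ τ₁)).prod (volume : Measure E)))
    (ha3 : ∀ τ ∈ Icc τ₀ τ₁, MemLp (a τ) 3 (volume : Measure E) ∧ eLpNorm (a τ) 3 volume ≤ M)
    (hb3 : ∀ τ ∈ Icc τ₀ τ₁, MemLp (b τ) 3 (volume : Measure E) ∧ eLpNorm (b τ) 3 volume ≤ M)
    {Φ : ℝ → E → E} {D : ℝ → E → E →L[ℝ] E}
    (hslice : ∀ t ∈ Ioc τ₀ τ₁, ∫ x, ⟪a t x - b t x, Φ t x⟫ =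
      ∫ y, (⟪a y.1 y.2, K t y (a y.1 y.2)⟫ - ⟪b y.1 y.2, K t y (b y.1 y.2)⟫)
        ∂((volume.restrict (Ioc τ₀ τ₁)).prod (volume : Measure E)))
    (hKint : ∀ y : ℝ × E, y.1 ∈ Ioc τ₀ τ₁ →
      IntegrableOn (fun t => K t y) (Ioc τ₀ τ₁) volume ∧ ∫ t in Ioc τ₀ τ₁, K t y = D y.1 y.2) :
    ∫ t in Ioc τ₀ τ₁, ∫ x, ⟪a t x - b t x, Φ t x⟫ =
      ∫ τ in Ioc τ₀ τ₁, ∫ x, (⟪a τ x, D τ x (a τ x)⟫ - ⟪b τ x, D τ x (b τ x)⟫) := by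
  have hJ := integrable_transportIntegrand hτ hK3 hR hK hKt ha hb ha3 hb3
  have hJ' : Integrable (uncurry fun (t : ℝ) (y : ℝ × E) =>
      ⟪a y.1 y.2, K t y (a y.1 y.2)⟫ - ⟪b y.1 y.2, K t y (b y.1 y.2)⟫)
      ((volume.restrict (Ioc τ₀ τ₁)).prod
        ((volume.restrict (Ioc τ₀ τ₁)).prod (volume : Measure E))) := hJ
  rw [setIntegral_congr_fun measurableSet_Ioc hslice, integral_integral_swap hJ']
  -- the time integral moves inside the pairing, for a.e. `y`
  have hI : ∀ᵐ y ∂((volume.restrict (Ioc τ₀ τ₁)).prod (volume : Measure E)), y.1 ∈ Ioc τ₀ τ₁ :=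
    (Measure.quasiMeasurePreserving_fst (μ := volume.restrict (Ioc τ₀ τ₁))
      (ν := (volume : Measure E))).ae
      (ae_restrict_mem measurableSet_Ioc)
  have e3 : ∀ᵐ y ∂((volume.restrict (Ioc τ₀ τ₁)).prod (volume : Measure E)),
      ∫ t in Ioc τ₀ τ₁, (⟪a y.1 y.2, K t y (a y.1 y.2)⟫ - ⟪b y.1 y.2, K t y (b y.1 y.2)⟫) =
        ⟪a y.1 y.2, D y.1 y.2 (a y.1 y.2)⟫ - ⟪b y.1 y.2, D y.1 y.2 (b y.1 y.2)⟫ := by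
    filter_upwards [hI] with y hy
    obtain ⟨hKi, hKD⟩ := hKint y hy
    have i1 : Integrable (fun t => ⟪a y.1 y.2, K t y (a y.1 y.2)⟫) (volume.restrict (Ioc τ₀ τ₁)) :=
      (hKi.apply_continuousLinearMap (a y.1 y.2)).const_inner (a y.1 y.2)
    have i2 : Integrable (fun t => ⟪b y.1 y.2, K t y (b y.1 y.2)⟫) (volume.restrict (Ioc τ₀ τ₁)) :=
      (hKi.apply_continuousLinearMap (b y.1 y.2)).const_inner (b y.1 y.2)
    rw [integral_sub i1 i2, integral_inner (hKi.apply_continuousLinearMap _),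
      integral_inner (hKi.apply_continuousLinearMap _), ← ContinuousLinearMap.integral_apply hKi,
      ← ContinuousLinearMap.integral_apply hKi, hKD]
  rw [integral_congr_ae e3]
  have hL : Integrable (fun y : ℝ × E =>
      ⟪a y.1 y.2, D y.1 y.2 (a y.1 y.2)⟫ - ⟪b y.1 y.2, D y.1 y.2 (b y.1 y.2)⟫)
      ((volume.restrict (Ioc τ₀ τ₁)).prod (volume : Measure E)) :=
    hJ.integral_prod_right.congr e3
  rw [integral_prod _ hL]

end SlabFubini2

/-! ### The duality identity -/

section Duality

variable {ν T : ℝ} {u v : ℝ → E → E} {u₀ : E → E} {Θ : ℝ → E → E}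

/-- The restricted Lebesgue measure on a time slab `S × E` is the product of the restricted
time measure with Lebesgue measure on `E` (any set `S`). [folklore] -/
theorem volume_restrict_prod_univ_eq_prod (S : Set ℝ) :
    (volume : Measure (ℝ × E)).restrict (S ×ˢ univ) =
      (volume.restrict S).prod (volume : Measure E) := by
  rw [show (volume : Measure (ℝ × E)) = (volume : Measure ℝ).prod (volume : Measure E) from rfl,
    ← Measure.restrict_univ (μ := (volume : Measure E)), Measure.prod_restrict,
    Measure.restrict_univ]

/-- Joint measurability on a sub-slab `(τ₀, τ₁] × E ⊆ (0, T) × E`. [folklore] -/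
theorem aestronglyMeasurable_uncurry_restrict_Ioc {a : ℝ → E → E} {τ₀ τ₁ : ℝ} (hτ₀ : 0 ≤ τ₀)
    (hτ₁ : τ₁ < T)
    (ha : AEStronglyMeasurable (uncurry a) ((volume : Measure (ℝ × E)).restrict (Ioo 0 T ×ˢ univ))) :
    AEStronglyMeasurable (uncurry a) ((volume.restrict (Ioc τ₀ τ₁)).prod (volume : Measure E)) := by
  rw [← volume_restrict_prod_univ_eq_prod]
  refine ha.mono_measure (Measure.restrict_mono (Set.prod_mono (fun τ hτ => ?_) le_rfl) le_rfl)
  exact ⟨hτ₀.trans_lt hτ.1, hτ.2.trans_lt hτ₁⟩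

/-- **The tested difference identity on the slab.** In the setting of the duality identity
(two unforced mild solutions agreeing on `[0, τ₀]`, bounded in `L³` on `[0, τ₁]`), for every
`t ∈ (τ₀, τ₁]`: `∫⟪u(t) - v(t), Θ(t)⟫` equals the integral over the slab `(τ₀, τ₁] × E` of the
transport integrand `⟪u, K_t u⟫ - ⟪v, K_t v⟫`, `K_t(τ, x) = 1_{τ<t} D(e^{ν(t-τ)Δ}Θ(t))(x)`
(P1's tested difference identity with `φ = Θ(t)`; the contribution of `(0, τ₀]` vanishes).
[cite: LemarieRieusset2016, proof of Thm. 7.7, second step (7.54), p. 148] -/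
theorem IsMildNSSolutionOn.integral_inner_sub_slice_eq_slab (hν : 0 < ν)
    (hΘ : IsSpaceTimeTestOn (⊤ : Opens (ℝ × E)) Θ) (hΘd : ∀ t, VectorCalculus.IsDivFree (Θ t))
    (h₁ : IsMildNSSolutionOn (Ico 0 T) ν 0 u₀ u) (h₂ : IsMildNSSolutionOn (Ico 0 T) ν 0 u₀ v)
    (hmu : AEStronglyMeasurable (uncurry u)
      ((volume : Measure (ℝ × E)).restrict (Ioo 0 T ×ˢ univ)))
    (hmv : AEStronglyMeasurable (uncurry v)
      ((volume : Measure (ℝ × E)).restrict (Ioo 0 T ×ˢ univ)))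
    {τ₀ τ₁ : ℝ} (hτ₀ : 0 ≤ τ₀) (hτ : τ₀ ≤ τ₁) (hτ₁ : τ₁ < T) {M : ℝ≥0}
    (hu3 : ∀ τ ∈ Icc 0 τ₁, MemLp (u τ) 3 (volume : Measure E) ∧ eLpNorm (u τ) 3 volume ≤ M)
    (hv3 : ∀ τ ∈ Icc 0 τ₁, MemLp (v τ) 3 (volume : Measure E) ∧ eLpNorm (v τ) 3 volume ≤ M)
    (hco : ∀ s ∈ Icc 0 τ₀, u s =ᵐ[volume] v s) {t : ℝ} (ht : t ∈ Ioc τ₀ τ₁) :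
    ∫ x, ⟪u t x - v t x, Θ t x⟫ =
      ∫ y, (⟪u y.1 y.2, (if y.1 < t then fderiv ℝ (heatTest ν (Θ t) (t - y.1)) y.2 else 0)
          (u y.1 y.2)⟫ -
        ⟪v y.1 y.2, (if y.1 < t then fderiv ℝ (heatTest ν (Θ t) (t - y.1)) y.2 else 0)
          (v y.1 y.2)⟫) ∂((volume.restrict (Ioc τ₀ τ₁)).prod (volume : Measure E)) := by
  have htT : t ∈ Ico 0 T := ⟨hτ₀.trans ht.1.le, ht.2.trans_lt hτ₁⟩
  have hφ := hΘ.isTestFunctionOn_slice t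
  have hφ1 : ContDiff ℝ 1 (Θ t) := contDiff_infty.1 (hΘ.contDiff_slice t) 1
  have hφc := hΘ.hasCompactSupport_slice t
  have hu3t : ∀ τ ∈ Icc 0 t, MemLp (u τ) 3 (volume : Measure E) ∧ eLpNorm (u τ) 3 volume ≤ M :=
    fun τ hτ' => hu3 τ ⟨hτ'.1, hτ'.2.trans ht.2⟩
  have hv3t : ∀ τ ∈ Icc 0 t, MemLp (v τ) 3 (volume : Measure E) ∧ eLpNorm (v τ) 3 volume ≤ M :=
    fun τ hτ' => hv3 τ ⟨hτ'.1, hτ'.2.trans ht.2⟩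
  have ht0 : t ∈ Icc 0 t := ⟨htT.1, le_rfl⟩
  have iu : Integrable (fun x => ⟪u t x, Θ t x⟫) volume :=
    integrable_inner_of_locallyIntegrable_of_hasCompactSupport
      ((hu3t t ht0).1.locallyIntegrable (by norm_num)) hφ.contDiff.continuous hφc
  have iv : Integrable (fun x => ⟪v t x, Θ t x⟫) volume :=
    integrable_inner_of_locallyIntegrable_of_hasCompactSupport
      ((hv3t t ht0).1.locallyIntegrable (by norm_num)) hφ.contDiff.continuous hφc
  have Iu := intervalIntegrable_transportPairing hν hφ1 hφc htT.1 htT.2.le hmu hmu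
    ENNReal.coe_lt_top ENNReal.coe_lt_top hu3t hu3t
  have Iv := intervalIntegrable_transportPairing hν hφ1 hφc htT.1 htT.2.le hmv hmv
    ENNReal.coe_lt_top ENNReal.coe_lt_top hv3t hv3t
  rw [h₁.integral_inner_sub_eq h₂ htT hφ (hΘd t) iu iv Iu Iv]
  simp only [convect]
  -- the contribution of `(0, τ₀]` vanishes
  have Iuv := Iu.sub Iv
  rw [← intervalIntegral.integral_add_adjacent_intervals (b := τ₀)
    (Iuv.mono_set (uIcc_subset_uIcc_left (mem_uIcc_of_le hτ₀ ht.1.le)))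
    (Iuv.mono_set (uIcc_subset_uIcc_right (mem_uIcc_of_le hτ₀ ht.1.le)))]
  have hz : ∫ τ in (0 : ℝ)..τ₀, ((∫ x, ⟪u τ x, fderiv ℝ (heatTest ν (Θ t) (t - τ)) x (u τ x)⟫) -
      ∫ x, ⟪v τ x, fderiv ℝ (heatTest ν (Θ t) (t - τ)) x (v τ x)⟫) = 0 := by
    rw [intervalIntegral.integral_of_le hτ₀]
    refine (setIntegral_congr_fun measurableSet_Ioc fun τ hτ' => ?_).trans
      (by simp : ∫ _ in Ioc (0 : ℝ) τ₀, (0 : ℝ) = 0)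
    refine sub_eq_zero.2 (integral_congr_ae ?_)
    filter_upwards [hco τ ⟨hτ'.1.le, hτ'.2⟩] with x hx
    rw [hx]
  rw [hz, zero_add, intervalIntegral.integral_of_le ht.1.le]
  -- the slab integral, by Fubini
  obtain ⟨R, hR, hRle⟩ := hΘ.exists_eLpNorm_fderiv_slice_le
  have hK3 : ∀ t' τ, MemLp (fun x => (fun (t' : ℝ) (y : ℝ × E) =>
      if y.1 < t' then fderiv ℝ (heatTest ν (Θ t') (t' - y.1)) y.2 else 0) t' (τ, x)) 3
        (volume : Measure E) ∧
      eLpNorm (fun x => (fun (t' : ℝ) (y : ℝ × E) =>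
        if y.1 < t' then fderiv ℝ (heatTest ν (Θ t') (t' - y.1)) y.2 else 0) t' (τ, x)) 3 volume ≤
        R := fun t' τ =>
    ⟨(hΘ.memLp_transportKernel hν t' τ).1, (hΘ.memLp_transportKernel hν t' τ).2.trans (hRle t')⟩
  have hslab := integrable_transportIntegrand_slab (a := u) (b := v)
    (K := fun (t' : ℝ) (y : ℝ × E) =>
      if y.1 < t' then fderiv ℝ (heatTest ν (Θ t') (t' - y.1)) y.2 else 0) (t := t) hτ hK3 hR
    (hΘ.aestronglyMeasurable_transportKernel_slice hν t _)
    (aestronglyMeasurable_uncurry_restrict_Ioc hτ₀ hτ₁ hmu)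
    (aestronglyMeasurable_uncurry_restrict_Ioc hτ₀ hτ₁ hmv)
    (fun τ hτ' => hu3 τ ⟨hτ₀.trans hτ'.1, hτ'.2⟩) (fun τ hτ' => hv3 τ ⟨hτ₀.trans hτ'.1, hτ'.2⟩)
  rw [integral_prod _ hslab.1]
  dsimp only
  -- restrict the time integral on the right to `(τ₀, t]`
  have hvan : ∀ τ, ¬ τ < t → (∫ x, (⟪u τ x,
      (if τ < t then fderiv ℝ (heatTest ν (Θ t) (t - τ)) x else 0) (u τ x)⟫ -
      ⟪v τ x, (if τ < t then fderiv ℝ (heatTest ν (Θ t) (t - τ)) x else 0) (v τ x)⟫)) = 0 := by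
    intro τ hτt
    simp [if_neg hτt]
  have e2 : (∫ τ in Ioc τ₀ τ₁, ∫ x, (⟪u τ x,
      (if τ < t then fderiv ℝ (heatTest ν (Θ t) (t - τ)) x else 0) (u τ x)⟫ -
      ⟪v τ x, (if τ < t then fderiv ℝ (heatTest ν (Θ t) (t - τ)) x else 0) (v τ x)⟫)) =
      ∫ τ in Ioc τ₀ t, ∫ x, (⟪u τ x,
        (if τ < t then fderiv ℝ (heatTest ν (Θ t) (t - τ)) x else 0) (u τ x)⟫ -
        ⟪v τ x, (if τ < t then fderiv ℝ (heatTest ν (Θ t) (t - τ)) x else 0) (v τ x)⟫) := by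
    have hind : EqOn (fun τ => ∫ x, (⟪u τ x,
        (if τ < t then fderiv ℝ (heatTest ν (Θ t) (t - τ)) x else 0) (u τ x)⟫ -
        ⟪v τ x, (if τ < t then fderiv ℝ (heatTest ν (Θ t) (t - τ)) x else 0) (v τ x)⟫))
        ((Iic t).indicator fun τ => ∫ x, (⟪u τ x,
          (if τ < t then fderiv ℝ (heatTest ν (Θ t) (t - τ)) x else 0) (u τ x)⟫ -
          ⟪v τ x, (if τ < t then fderiv ℝ (heatTest ν (Θ t) (t - τ)) x else 0) (v τ x)⟫))
        (Ioc τ₀ τ₁) := fun τ _ => by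
      by_cases h : τ ≤ t
      · rw [indicator_of_mem (show τ ∈ Iic t from h)]
      · rw [indicator_of_notMem (show τ ∉ Iic t from h)]
        exact hvan τ fun hlt => h hlt.le
    rw [setIntegral_congr_fun measurableSet_Ioc hind, setIntegral_indicator measurableSet_Iic,
      Ioc_inter_Iic, inf_of_le_right ht.2]
  rw [e2]
  refine setIntegral_congr_ae measurableSet_Ioc ?_
  filter_upwards [measure_eq_zero_iff_ae_notMem.1 (measure_singleton t)] with τ hτt hτ'
  have hlt : τ < t := lt_of_le_of_ne hτ'.2 hτt
  have hτI : τ ∈ Icc 0 τ₁ := ⟨hτ₀.trans hτ'.1.le, hτ'.2.trans ht.2⟩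
  have hΨ : MemLp (fderiv ℝ (heatTest ν (Θ t) (t - τ))) 3 (volume : Measure E) :=
    memLp_fderiv_heatTest hν (sub_pos.2 hlt).le hφ1 hφc (by norm_num)
  have i1 := (integral_inner_clm_apply_le (hu3 τ hτI).1 (hu3 τ hτI).1 hΨ).1
  have i2 := (integral_inner_clm_apply_le (hv3 τ hτI).1 (hv3 τ hτI).1 hΨ).1
  simp only [if_pos hlt]
  exact (integral_sub i1 i2).symm

/-- **The duality identity** (Lemarié-Rieusset 2016, proof of Thm. 7.7, fourth step, p. 149:
`∫∫ (u ⊗ u - v ⊗ v) · ∇𝒰[Θ] = ∫⟨w, Θ⟩ dt` with `𝒰[Θ](τ) = ∫_τ^∞ e^{ν(t-τ)Δ} Θ(t) dt` the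
solution of the backward heat equation `-∂_τ𝒰 - νΔ𝒰 = Θ`; there for `L = -∂_t² + Δ²`, here for
the heat operator as in Monniaux's proof). Let `u`, `v` be two unforced mild solutions on
`[0, T)` in the duality form with the same datum, jointly measurable, bounded by `M` in `L³` on
`[0, τ₁]` and agreeing a.e. on `[0, τ₀]`, `0 ≤ τ₀ ≤ τ₁ < T`; let `Θ` be a space-time test field
with divergence-free slices and time support in `[a, b]`, `b ≤ τ₁`. Then
`∫_{(τ₀,τ₁]} ∫⟪u(t) - v(t), Θ(t)⟫ dt = ∫_{(τ₀,τ₁]} ∫ (⟪u, D𝒰[Θ] u⟫ - ⟪v, D𝒰[Θ] v⟫) dτ`,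
`𝒰[Θ] = heatDuhamelBack ν Θ`. [cite: LemarieRieusset2016, proof of Thm. 7.7, fourth step, p. 149] -/
theorem IsMildNSSolutionOn.slab_duality (hν : 0 < ν)
    (hΘ : IsSpaceTimeTestOn (⊤ : Opens (ℝ × E)) Θ) (hΘd : ∀ t, VectorCalculus.IsDivFree (Θ t))
    (h₁ : IsMildNSSolutionOn (Ico 0 T) ν 0 u₀ u) (h₂ : IsMildNSSolutionOn (Ico 0 T) ν 0 u₀ v)
    (hmu : AEStronglyMeasurable (uncurry u)
      ((volume : Measure (ℝ × E)).restrict (Ioo 0 T ×ˢ univ)))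
    (hmv : AEStronglyMeasurable (uncurry v)
      ((volume : Measure (ℝ × E)).restrict (Ioo 0 T ×ˢ univ)))
    {τ₀ τ₁ : ℝ} (hτ₀ : 0 ≤ τ₀) (hτ : τ₀ ≤ τ₁) (hτ₁ : τ₁ < T) {M : ℝ≥0}
    (hu3 : ∀ τ ∈ Icc 0 τ₁, MemLp (u τ) 3 (volume : Measure E) ∧ eLpNorm (u τ) 3 volume ≤ M)
    (hv3 : ∀ τ ∈ Icc 0 τ₁, MemLp (v τ) 3 (volume : Measure E) ∧ eLpNorm (v τ) 3 volume ≤ M)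
    (hco : ∀ s ∈ Icc 0 τ₀, u s =ᵐ[volume] v s) {a b : ℝ} (hab : ∀ t, t ∉ Icc a b → Θ t = 0)
    (hb : b ≤ τ₁) :
    ∫ t in Ioc τ₀ τ₁, ∫ x, ⟪u t x - v t x, Θ t x⟫ =
      ∫ τ in Ioc τ₀ τ₁, ∫ x, (⟪u τ x, fderiv ℝ (heatDuhamelBack ν Θ τ) x (u τ x)⟫ -
        ⟪v τ x, fderiv ℝ (heatDuhamelBack ν Θ τ) x (v τ x)⟫) := by
  obtain ⟨R, hR, hRle⟩ := hΘ.exists_eLpNorm_fderiv_slice_le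
  have hK3 : ∀ t' τ, MemLp (fun x => (fun (t' : ℝ) (y : ℝ × E) =>
      if y.1 < t' then fderiv ℝ (heatTest ν (Θ t') (t' - y.1)) y.2 else 0) t' (τ, x)) 3
        (volume : Measure E) ∧
      eLpNorm (fun x => (fun (t' : ℝ) (y : ℝ × E) =>
        if y.1 < t' then fderiv ℝ (heatTest ν (Θ t') (t' - y.1)) y.2 else 0) t' (τ, x)) 3 volume ≤
        R := fun t' τ =>
    ⟨(hΘ.memLp_transportKernel hν t' τ).1, (hΘ.memLp_transportKernel hν t' τ).2.trans (hRle t')⟩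
  refine setIntegral_slab_duality (a := u) (b := v)
    (K := fun (t' : ℝ) (y : ℝ × E) =>
      if y.1 < t' then fderiv ℝ (heatTest ν (Θ t') (t' - y.1)) y.2 else 0)
    hτ hK3 hR (hΘ.aestronglyMeasurable_transportKernel hν _)
    (fun t => hΘ.aestronglyMeasurable_transportKernel_slice hν t _)
    (aestronglyMeasurable_uncurry_restrict_Ioc hτ₀ hτ₁ hmu)
    (aestronglyMeasurable_uncurry_restrict_Ioc hτ₀ hτ₁ hmv)
    (fun τ hτ' => hu3 τ ⟨hτ₀.trans hτ'.1, hτ'.2⟩) (fun τ hτ' => hv3 τ ⟨hτ₀.trans hτ'.1, hτ'.2⟩)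
    (fun t ht => h₁.integral_inner_sub_slice_eq_slab hν hΘ hΘd h₂ hmu hmv hτ₀ hτ hτ₁ hu3 hv3 hco ht)
    (fun y hy => ⟨hΘ.integrableOn_transportKernel_time hν τ₀ τ₁ y.1 y.2,
      hΘ.setIntegral_transportKernel_eq_fderiv_heatDuhamelBack hν hab hb (Ioc_subset_Icc_self hy)
        y.2⟩)

/-- **Split (trilinear) form of the duality identity**: with `w = u - v` and `𝒰 = 𝒰[Θ]`,
`∫_{(τ₀,τ₁]} ∫⟪w(t), Θ(t)⟫ dt = ∫_{(τ₀,τ₁]} ∫ (⟪w, D𝒰 u⟫ + ⟪v, D𝒰 w⟫) dτ`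
(`u ⊗ u - v ⊗ v = w ⊗ u + v ⊗ w`, Lemarié-Rieusset 2016, (7.54)). [cite: LemarieRieusset2016, proof of Thm. 7.7, (7.54) and fourth step, pp. 148–149] -/
theorem IsMildNSSolutionOn.slab_duality_split (hν : 0 < ν)
    (hΘ : IsSpaceTimeTestOn (⊤ : Opens (ℝ × E)) Θ) (hΘd : ∀ t, VectorCalculus.IsDivFree (Θ t))
    (h₁ : IsMildNSSolutionOn (Ico 0 T) ν 0 u₀ u) (h₂ : IsMildNSSolutionOn (Ico 0 T) ν 0 u₀ v)
    (hmu : AEStronglyMeasurable (uncurry u)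
      ((volume : Measure (ℝ × E)).restrict (Ioo 0 T ×ˢ univ)))
    (hmv : AEStronglyMeasurable (uncurry v)
      ((volume : Measure (ℝ × E)).restrict (Ioo 0 T ×ˢ univ)))
    {τ₀ τ₁ : ℝ} (hτ₀ : 0 ≤ τ₀) (hτ : τ₀ ≤ τ₁) (hτ₁ : τ₁ < T) {M : ℝ≥0}
    (hu3 : ∀ τ ∈ Icc 0 τ₁, MemLp (u τ) 3 (volume : Measure E) ∧ eLpNorm (u τ) 3 volume ≤ M)
    (hv3 : ∀ τ ∈ Icc 0 τ₁, MemLp (v τ) 3 (volume : Measure E) ∧ eLpNorm (v τ) 3 volume ≤ M)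
    (hco : ∀ s ∈ Icc 0 τ₀, u s =ᵐ[volume] v s) {a b : ℝ} (hab : ∀ t, t ∉ Icc a b → Θ t = 0)
    (hb : b ≤ τ₁) :
    ∫ t in Ioc τ₀ τ₁, ∫ x, ⟪u t x - v t x, Θ t x⟫ =
      ∫ τ in Ioc τ₀ τ₁, ∫ x, (⟪u τ x - v τ x, fderiv ℝ (heatDuhamelBack ν Θ τ) x (u τ x)⟫ +
        ⟪v τ x, fderiv ℝ (heatDuhamelBack ν Θ τ) x (u τ x - v τ x)⟫) := by
  rw [h₁.slab_duality hν hΘ hΘd h₂ hmu hmv hτ₀ hτ hτ₁ hu3 hv3 hco hab hb]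
  refine setIntegral_congr_fun measurableSet_Ioc fun τ _ => integral_congr_ae
    (Eventually.of_forall fun x => ?_)
  simp only [inner_sub_left, map_sub, inner_sub_right]
  ring

end Duality



end Literature.Analysis.FluidPDE
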